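import Mathlib
import Summits.Ventures.HodgeRepro.Tier4.Common.TestProjector

/-!
# Tier4/Common/TestProjectorSupport — the SUPPORTS of the projected test functions `e ⋆ f`, `f ⋆ e`, `e ⋆ f ⋆ e`

Blind re-derivation cell `pub-hodge-repro`, Tier 4 «prove the step» (README §9–§10), seat t4-typer-2 (gen 3).
Target tree path `lean/Summits/Ventures/HodgeRepro/Tier4/Common/TestProjectorSupport.lean`.  Mathlib +
`Common.TestProjector` (`lProj`, `rProj`, `biProj`); no literature.

WHY (t4-plan-4 g3 S14260, cut C-L4-PROJSUPP (1): «support ⊆ C⁻¹ · tsupport · C⁻¹ exactly as inside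
`hasCompactSupport_lProj` / `hasCompactSupport_rProj`»): the vanishing statements inside those two proofs, exposed as
lemmas, and the closed-support inclusions they give on a Hausdorff group (`C` compact, so `C · tsupport f` is compact
hence closed and `closure_minimal` applies); `inv_coe_set` removes the inverses (`(C : Set G)⁻¹ = C`).

* `lProj_eq_zero_of_notMem`, `rProj_eq_zero_of_notMem` — `e ⋆ f` vanishes off `C⁻¹ · tsupport f`, `f ⋆ e` off
  `tsupport f · C⁻¹`;
* **`tsupport_lProj_subset`**, **`tsupport_rProj_subset`** — `tsupport (e ⋆ f) ⊆ C · tsupport f`,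
  `tsupport (f ⋆ e) ⊆ tsupport f · C`;
* **`tsupport_biProj_subset`** — `tsupport (e ⋆ f ⋆ e) ⊆ C · tsupport f · C`.

Nothing here says anything about the status of the Hodge conjecture for CM abelian varieties, which is NOT proved
(HC_CM is NOT proved by anyone in this repository).
-/

set_option autoImplicit false

noncomputable section

namespace Summit.Ventures.HodgeRepro.Tier4.Common

open MeasureTheory Topology
open scoped Pointwise

section Support

variable {G : Type*} [Group G] [TopologicalSpace G] [IsTopologicalGroup G] [MeasurableSpace G]
  (C : Subgroup G) (ν : Measure C)

omit [IsTopologicalGroup G] in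
/-- `e ⋆ f` vanishes off `C⁻¹ · tsupport f`. -/
theorem lProj_eq_zero_of_notMem {χ f : G → ℂ} {y : G} (hy : y ∉ (C : Set G)⁻¹ * tsupport f) :
    lProj C ν χ f y = 0 := by
  have hzero : ∀ κ : C, f (κ * y) = 0 := by
    intro κ
    apply image_eq_zero_of_notMem_tsupport
    intro hmem
    apply hy
    refine ⟨(κ : G)⁻¹, ?_, (κ : G) * y, hmem, by group⟩
    rw [Set.mem_inv, inv_inv]
    exact κ.2
  simp only [lProj, hzero, mul_zero, integral_zero]

omit [IsTopologicalGroup G] in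
/-- `f ⋆ e` vanishes off `tsupport f · C⁻¹`. -/
theorem rProj_eq_zero_of_notMem {χ f : G → ℂ} {y : G} (hy : y ∉ tsupport f * (C : Set G)⁻¹) :
    rProj C ν χ f y = 0 := by
  have hzero : ∀ κ : C, f (y * κ) = 0 := by
    intro κ
    apply image_eq_zero_of_notMem_tsupport
    intro hmem
    apply hy
    refine ⟨y * κ, hmem, (κ : G)⁻¹, ?_, by group⟩
    rw [Set.mem_inv, inv_inv]
    exact κ.2
  simp only [rProj, hzero, mul_zero, integral_zero]

/-- **`tsupport (e ⋆ f) ⊆ C · tsupport f`** (`G` Hausdorff, `C` compact, `f` compactly supported). -/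
theorem tsupport_lProj_subset [T2Space G] [CompactSpace C] {χ f : G → ℂ} (hfc : HasCompactSupport f) :
    tsupport (lProj C ν χ f) ⊆ (C : Set G) * tsupport f := by
  have hC : IsCompact (C : Set G) := isCompact_iff_compactSpace.2 inferInstance
  refine closure_minimal ?_ (hC.mul hfc).isClosed
  intro y hy
  by_contra h
  apply hy
  apply lProj_eq_zero_of_notMem C ν
  rwa [inv_coe_set]

/-- **`tsupport (f ⋆ e) ⊆ tsupport f · C`** (`G` Hausdorff, `C` compact, `f` compactly supported). -/
theorem tsupport_rProj_subset [T2Space G] [CompactSpace C] {χ f : G → ℂ} (hfc : HasCompactSupport f) :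
    tsupport (rProj C ν χ f) ⊆ tsupport f * (C : Set G) := by
  have hC : IsCompact (C : Set G) := isCompact_iff_compactSpace.2 inferInstance
  refine closure_minimal ?_ (hfc.mul hC).isClosed
  intro y hy
  by_contra h
  apply hy
  apply rProj_eq_zero_of_notMem C ν
  rwa [inv_coe_set]

/-- **`tsupport (e ⋆ f ⋆ e) ⊆ C · tsupport f · C`.** -/
theorem tsupport_biProj_subset [T2Space G] [CompactSpace C] {χ f : G → ℂ}
    (hfc : HasCompactSupport f) :
    tsupport (biProj C ν χ f) ⊆ (C : Set G) * tsupport f * (C : Set G) := by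
  have h1 : tsupport (biProj C ν χ f) ⊆ (C : Set G) * tsupport (rProj C ν χ f) :=
    tsupport_lProj_subset C ν (hasCompactSupport_rProj C ν hfc)
  refine h1.trans ?_
  rw [mul_assoc]
  exact Set.mul_subset_mul_left (tsupport_rProj_subset C ν hfc)

end Support

end Summit.Ventures.HodgeRepro.Tier4.Common

end
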